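import Summits.CriticalPhenomena.PercolationContinuityZ3.Theorems.SahiMasterFamilyUpperMaster
import Summits.CriticalPhenomena.PercolationContinuityZ3.Theorems.SahiMasterFamilyUpperMasterFiveCert1
import Summits.CriticalPhenomena.PercolationContinuityZ3.Theorems.SahiMasterFamilyUpperMasterFiveCert2

/-!
# The upper master inequality at order 5: `Φ_5(β) ≤ 24·(β_⊤ − ∏_i β_i)` for supermultiplicative set functions, and
# `E_5(1_{A_0},…) ≤ 24·(μ(⋂A_i) − ∏ μ(A_i))` for increasing events

Unit `prim-masterthm-p4` (gen 13; crux anchor stmt-CriticalPhenomena-4575, helper work; memo P4-GEN13-REPORT.md §6/§9).  Companion of `…UpperMaster` (orders 3, 4).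
CERTIFICATE (kit j124697, symmetry-reduced LP, verified exactly): a non-negative combination of "merge gaps" `(β_{c∪c'} − β_c β_{c'})·∏_{other blocks} β_B`
(= `w(merged) − w(split)` for the cycle weights of Sahi's functional), chunks `…UpperMasterFiveCert*`.  Event form (increasing events, via `PrincipalCapBeta.sahiE_eq_phiSet` + Harris): `…UpperMasterEvents`.
Conjecture U(n) for all n: `UpperMaster.PhiLeTopGap` (typed in `…UpperMaster`); the uniform 'merge-matching' scheme provably stops at n = 8 (c(8,3) > c(8,2)).
HONEST FRAMING: an UPPER bound; Sahi's lower bound `C_5` remains OPEN in general.  Axioms standard. [this work]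
-/

noncomputable section

open scoped Classical

namespace Summit.CriticalPhenomena.PercolationContinuityZ3.Theorems

namespace UpperMaster

open Finset Function
open Literature.Combinatorics.Sahi2008
open Literature.Probability.Percolation.DecisionTree (ind)

set_option maxRecDepth 200000 in
set_option maxHeartbeats 8000000 in
/-- **Abstract `U(5)`**: `Φ_5(β) ≤ 24(β_⊤ − ∏β_i)` for every non-negative supermultiplicative set function on `Finset (Fin 5)`. [this work] -/
theorem phiSet_five_le_top_gap (β : Finset (Fin 5) → ℝ) (h0 : ∀ B, 0 ≤ β B) (hsup : ∀ S T, β S * β T ≤ β (S ∪ T)) :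
    PrincipalCapBeta.phiSet 5 β ≤ 24 * (β univ - β {0} * β {1} * β {2} * β {3} * β {4}) := by
  have hsum := (add_nonneg (u5piece1_nonneg β h0 hsup) (u5piece2_nonneg β h0 hsup))
  rw [u5piece1_eq β, u5piece2_eq β] at hsum
  rw [PrincipalCapBeta.phiSet_five]
  linarith [hsum]

/-- **`U(5)` in the typed form** `PhiLeTopGap 5`. [this work] -/
theorem phiLeTopGap_five : PhiLeTopGap 5 := by
  intro β h0 hsup
  have h := phiSet_five_le_top_gap β h0 hsup
  have e : ∏ i : Fin 5, β {i} = β {0} * β {1} * β {2} * β {3} * β {4} := by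
    rw [Fin.prod_univ_five]
  rw [e]; norm_num [Nat.factorial]; linarith

end UpperMaster

end Summit.CriticalPhenomena.PercolationContinuityZ3.Theorems
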